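import Literature.MathematicalPhysics.QuantumFieldTheory.Balaban1985CMP102.SectB
import Summits.QuantumFields.Balaban3D.Proofs.SectAFirstStep

/-!
# `Summit.QuantumFields.Balaban3D.Proofs.Step0Tower` — [Balaban1985UV3] (1) p. 256 at k = 0 ON THE SPINE'S TOWER OBJECTS: for every
# `W : SectB.TowerObjects S G` (typer-1) whose k = 0 data are the printed ones — one history with `LF 0 V F = exp (F triv)`, `U₀ = id`,
# empty interaction sum — the k = 0 contract `SectAFirstStep.Step0Data W.toTowerRun` holds, hence `B10.Step0Printed W.toTowerRun`
# (= `LeafSystem.step0`), `NoInteraction0`, `Rm 0 ≤ 0` — lane `pub-balaban3d`, seat p4 (LEAF-LEDGER B11/B12/B23, ruling R-K0)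

HONEST FRAMING (lane PLAN.md §0, binding): see `…Proofs.SectAFirstStep`.  Bookkeeping over the spine's `TowerObjects`
(`Zterm 0`, `Rm 0` are empty `Finset.range 0` sums, `Ecst 0 = B10.Ek Estep K 0 = E` by `E_eq`, `ρ₀` by (1)); the three k = 0 facts
that are NOT definitional for an arbitrary `TowerObjects` are hypotheses: `hLF` (p1's `Carriers.Tower.tower3_lf_zero`), `hU0` (p1's
`ukAll`: `U₀ = id`, definitional for `tower3`), `hP0` ((43) at k = 0: the interaction sum «Σ_{j=1}^{0}» is empty — a statement about
the expansion data `Pint`, (α)-class per ruling R-DISP).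

WHAT THIS FILE PROVES (no `sorry`, axioms standard; theorems only):
* `rho_zero_towerObjects` — (1) for `W.toTowerRun` in the `Step0Data.rho_zero` shape, from `hU0`;
* `step0Data_towerObjects : hLF → hU0 → hP0 → Step0Data W.toTowerRun`;
* `step0_towerObjects : … → B10.Step0Printed W.toTowerRun` (LeafSystem.step0), `noInt0_towerObjects`, `rm_zero_towerObjects`.
p1's `tower3 D = (towerWith D _).pin` is a `TowerObjects`; with `hLF := D.tower3_lf_zero`, `hU0 := fun V => rfl`-level (`ukAll`) and
`hP0` the (43)@0 property of `D.Pint`, B11/B12/B23 are instantiated for the constructed tower.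
-/

namespace Summit.QuantumFields.Balaban3D.Proofs.Step0Tower

open Literature.MathematicalPhysics.QuantumFieldTheory.Balaban1983to89
open Literature.MathematicalPhysics.QuantumFieldTheory.Balaban1985CMP102
open Literature.MathematicalPhysics.QuantumFieldTheory.Balaban1985CMP102.Setting
open Summit.QuantumFields.Balaban3D.Proofs.SectAFirstStep (Step0Data step0_of_data noInt0_of_data rm_zero_of_data)

variable {L : ℕ} {S : Scales L} {G : Type} [GaugeGroup G] [MeasurableSpace G] [HaarData G] (W : SectB.TowerObjects S G)

/-- `η₀ = 1`. [folklore] -/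
theorem eta_zero (S : Scales L) : S.eta 0 = 1 := by
  unfold Scales.eta Params.eta
  rw [pow_zero]

/-- `(g₀)⁻² = 1/g₀²` (`g₀ = gε^{1/2}`, `g₀² = g²ε`, (1) p. 256 L4). [cite: Balaban1985UV3, (1) p.256] -/
theorem gk_zero_inv_sq (S : Scales L) : (S.gk 0)⁻¹ ^ 2 = 1 / S.g0sq := by
  unfold Scales.gk B10.gRun Scales.g0sq
  rw [pow_zero, one_mul, inv_pow, mul_pow, Real.sq_sqrt S.ε_pos.le, one_div]

/-- **(1) p. 256 on the tower objects** in the `Step0Data.rho_zero` shape: with `U₀ = id` (`hU0`),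
`ρ₀(U) = exp[−(g₀)⁻²·A^η(U₀(U)) − E₀]`, `E₀ = E` (`TowerObjects.E_eq`, (64)). [cite: Balaban1985UV3, (1) p.256] -/
theorem rho_zero_towerObjects (hU0 : ∀ V : GaugeField S.P 0 G, W.Uk 0 V = V) (U : GaugeField S.P 0 G) :
    W.toTowerRun.ρ 0 U = Real.exp (-((W.toTowerRun.g 0)⁻¹ ^ 2 * W.toTowerRun.wilsonBG 0 U) - W.toTowerRun.Ecst 0) := by
  show W.rho 0 U = Real.exp (-((S.gk 0)⁻¹ ^ 2 * W.mainTerm 0 U) - B10.Ek W.Estep S.K 0)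
  have hmain : W.mainTerm 0 U = wilsonAction4 U := by
    show S.actionEta 0 (W.Uk 0 U) = wilsonAction4 U
    rw [hU0]
    unfold Scales.actionEta wilsonAction4
    rw [eta_zero, inv_one]
  rw [gk_zero_inv_sq, hmain, ← W.E_eq]
  show W.rho0 U = _
  unfold RunObjects.rho0
  ring_nf

/-- The characteristic function (4) is `≤ 1`. [cite: Balaban1985UV3, (4) p.256] -/
theorem chi_le_one (k : ℕ) (V : GaugeField S.P k G) : W.chi k V ≤ 1 := by
  unfold RunObjects.chi chiSmall
  split_ifs <;> norm_num

/-- **The k = 0 contract for the spine's tower objects**: `Step0Data W.toTowerRun` from (i) the canonical k = 0 history functional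
`LF 0 V F = exp (F (triv 0))` (p1's `tower3_lf_zero`), (ii) `U₀ = id`, (iii) (43) at k = 0: `Pint 0 ≡ 0`; the clauses `Rm 0 = 0`
(empty sum «Σ_{j=0}^{−1}») and `χ ≤ 1` hold for every `TowerObjects`. [cite: Balaban1985UV3, (1) p.256] -/
theorem step0Data_towerObjects (hLF : ∀ (V : GaugeField S.P 0 G) (F : W.Hist 0 → ℝ), W.LF 0 V F = Real.exp (F (W.triv 0)))
    (hU0 : ∀ V : GaugeField S.P 0 G, W.Uk 0 V = V) (hP0 : ∀ (h : W.Hist 0) (V : GaugeField S.P 0 G), W.Pint 0 h V = 0) :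
    Step0Data W.toTowerRun where
  lf_triv V F := le_of_eq (hLF V F).symm
  rho_zero := rho_zero_towerObjects W hU0
  pint_zero := hP0
  rm_zero := by
    show W.Rm 0 = 0
    unfold SectB.TowerObjects.Rm
    rw [Finset.range_zero, Finset.sum_empty]
  chi_le_one := chi_le_one W 0

/-- **`LeafSystem.step0` for the spine's tower objects** (B11): (41)₀ ∧ (47)₀ = `B10.Step0Printed W.toTowerRun`.
[cite: Balaban1985UV3, (1) p.256] -/
theorem step0_towerObjects (hLF : ∀ (V : GaugeField S.P 0 G) (F : W.Hist 0 → ℝ), W.LF 0 V F = Real.exp (F (W.triv 0)))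
    (hU0 : ∀ V : GaugeField S.P 0 G, W.Uk 0 V = V) (hP0 : ∀ (h : W.Hist 0) (V : GaugeField S.P 0 G), W.Pint 0 h V = 0) :
    B10.Step0Printed W.toTowerRun :=
  step0_of_data (step0Data_towerObjects W hLF hU0 hP0)

/-- `LeafSystem.noInt0` for the tower objects (B12) — (43) at k = 0. [cite: Balaban1985UV3, (43) p.266] -/
theorem noInt0_towerObjects (hP0 : ∀ (h : W.Hist 0) (V : GaugeField S.P 0 G), W.Pint 0 h V = 0) :
    B10LargeField.NoInteraction0 W.toTowerRun := hP0

/-- `LeafSystem.Rm_zero` for the tower objects (B23): the remainder sum of (41)/(47) is empty at k = 0. [cite: Balaban1985UV3, (41) p.266] -/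
theorem rm_zero_towerObjects : W.toTowerRun.Rm 0 ≤ 0 := by
  show W.Rm 0 ≤ 0
  unfold SectB.TowerObjects.Rm
  rw [Finset.range_zero, Finset.sum_empty]

/-- The same three facts for the PINNED objects `W.pin` (p1's `tower3 = (towerWith _).pin`; p3 assembles over the pin): pinning
changes only the slot, so the hypotheses transfer verbatim (`pin_rho` for ρ₀ is definitional at k = 0). [folklore] -/
theorem step0_pin (hLF : ∀ (V : GaugeField S.P 0 G) (F : W.Hist 0 → ℝ), W.LF 0 V F = Real.exp (F (W.triv 0)))
    (hU0 : ∀ V : GaugeField S.P 0 G, W.Uk 0 V = V) (hP0 : ∀ (h : W.Hist 0) (V : GaugeField S.P 0 G), W.Pint 0 h V = 0) :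
    B10.Step0Printed W.pin.toTowerRun :=
  step0_towerObjects W.pin hLF hU0 hP0

end Summit.QuantumFields.Balaban3D.Proofs.Step0Tower
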